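import Literature.AnabelianGeometry.EtaleTheta.Setting
import Literature.AnabelianGeometry.EtaleTheta.SettingCompletion
import Literature.AnabelianGeometry.EtaleTheta.CyclotomeZHatAction
import Literature.AnabelianGeometry.SemiGraphs.ProfiniteCompletionExtend
import Mathlib.Topology.Algebra.ClopenNhdofOne
import Mathlib.Topology.Algebra.OpenSubgroup
import Mathlib.Topology.Homeomorph.Lemmas
import HarnessLib

/-!
# [EtTh] §1 pp. 12–13: `Π_X / (ι Π^tp_Y)⁻ ≅ Ẑ` and `Δ_X / (ι Δ^tp_Y)⁻ ≅ Ẑ` from the ROOT data alone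

Mochizuki, *The étale theta function and its Frobenioid-theoretic manifestations*, Publ. RIMS **45** (2009)
[EtTh], §1, PRIMS PDF p. 12 (printed 238): "the universal graph-covering of the dual graph of this special
fiber determines … a natural surjection `Π^tp_X ↠ Z`", "`Π^tp_Y`" its kernel, `Y^log → X^log` "an infinite
étale covering" with group `Z ≅ ℤ`; p. 13 (printed 239) "`Δ^tp_X/Δ^tp_Y ≅ Z`" [cite: MochizukiEtTh2009, §1 p.12].
Layer L2 of the abc-iut cell, seat abc-iut-L2-t7 (gen 3); PROOF-ONLY (no `def`, no `instance`, no named fact);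
nothing of another seat edited or restated.

THE PROFINITE FORM, for EVERY `D : ThetaSetting p` (no origin guard; only the root fields `toZ_delta_surjective`,
`isOpen_ker_toZ`, `IsProfiniteCompletion toHat`), `ι = toHat : Π^tp_X → Π_X`:
* `ThetaSetting.closureGtpY_normal` / `closureDtpY_normal` — `(ι Π^tp_Y)⁻`, `(ι Δ^tp_Y)⁻` are NORMAL in `Π_X`;
* `ThetaSetting.exists_piHat_hom_zHat` — a continuous SURJECTION `Λ : Π_X ↠ Ẑ` with `Λ (ι x) = η(toZ x)` (the
  profinite completion of `Π^tp_X ↠ Z`), `Ker Λ = (ι Π^tp_Y)⁻`, `Ker Λ ∩ Δ_X = (ι Δ^tp_Y)⁻`, `Λ(Δ_X) = Ẑ`;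
* `ThetaSetting.nonempty_piHat_quotient_(continuousM|m)ulEquiv_zHat` — `Π_X/(ι Π^tp_Y)⁻ ≅ Ẑ` (topologically);
* `ThetaSetting.nonempty_deltaHat_quotient_(continuousM|m)ulEquiv_zHat` — `Δ_X/(ι Δ^tp_Y)⁻ ≅ Ẑ` (topologically):
  the X-level complement of abc-iut-w5-d006's `Sec1DtpYEllClosureZHat.lean` (`(ι Δ^tp_Y)⁻/((ι Δ^tp_Y)⁻ ∩
  [Δ_X,Δ_X]⁻) ≅ Ẑ` under `IsEtThOrigin`); together they present `Δ^ell_X = Δ_X/[Δ_X,Δ_X]⁻` as an extension of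
  `Ẑ` by `Ẑ` — group structure only, no Tate twist claimed.
Generic engine `ClosureKerZHat.*` (topological group theory over the tree's `SemiGraphs.IsProfiniteCompletion ι`):
for `ι : G → Ĝ` a profinite completion and `τ : G → ℤ` with OPEN kernel, the finite levels `G → ℤ/H` extend
uniquely to `Ĝ` (abc-iut-L2-t1's `IsProfiniteCompletion.exists_extend`) and assemble into a continuous
`Λ : Ĝ → Ẑ = lim ℤ/H` with `Λ ∘ ι = η ∘ τ`; for a subgroup `A ≤ G` on which `τ` is surjective,
`Ker Λ ∩ (ι A)⁻ = (ι (A ∩ Ker τ))⁻` (an open normal `V ⊴ Ĝ` of index `m` contains `ι σ^m`, `τ σ = 1`; shrink to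
`V ∩ Ker Λ_m` and correct an `A`-approximant by a power of `σ^m`) and `Λ((ι A)⁻) = Ẑ` (compact image ⊇ `η(ℤ)`).

HONEST FRAMING: [EtTh] is refereed; the theta setting is DATA quoting print, not asserted to exist for an actual
curve; group structure only; nothing here bears on [IUTchIII] Cor. 3.12; typed ≠ proved elsewhere; no side taken.
-/

noncomputable section

namespace Literature.AnabelianGeometry.EtaleTheta

open Literature.AnabelianGeometry.SemiGraphs
open _root_.Topology
open CategoryTheory ProfiniteGrp ProfiniteGrp.ProfiniteCompletion

/-! ## Generic engine: the profinite completion of a surjection onto `ℤ` with open kernel -/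

namespace ClosureKerZHat

variable {G Ĝ : Type*} [Group G] [TopologicalSpace G] [IsTopologicalGroup G]
  [Group Ĝ] [TopologicalSpace Ĝ] [IsTopologicalGroup Ĝ] {ι : G →ₜ* Ĝ}

omit [IsTopologicalGroup G] in
/-- The closure of the image of a NORMAL subgroup under a homomorphism with dense range is normal
([SemiAnbd] §6 p. 69: closures in `Π = (Π^temp)^∧` of normal subgroups of `Π^temp`).
[cite: MochizukiSemiAnbd2006, §6 p.69] -/
theorem normal_topologicalClosure_map (hι : DenseRange ι) (N : Subgroup G) [hN : N.Normal] :
    ((N.map ι.toMonoidHom).topologicalClosure).Normal := by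
  refine ⟨fun h hh q => ?_⟩
  have hclosed : IsClosed {q : Ĝ | q * h * q⁻¹ ∈ (N.map ι.toMonoidHom).topologicalClosure} :=
    (Subgroup.isClosed_topologicalClosure _).preimage (by fun_prop)
  refine hι.induction_on q hclosed fun g => ?_
  have hc : Continuous fun x : Ĝ => ι g * x * (ι g)⁻¹ := by fun_prop
  have himg : (fun x : Ĝ => ι g * x * (ι g)⁻¹) '' ((N.map ι.toMonoidHom : Subgroup Ĝ) : Set Ĝ) ⊆
      ((N.map ι.toMonoidHom : Subgroup Ĝ) : Set Ĝ) := by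
    rintro _ ⟨x, ⟨d, hd, rfl⟩, rfl⟩
    refine ⟨g * d * g⁻¹, hN.conj_mem d hd g, ?_⟩
    simp [map_mul, map_inv]
  have := image_closure_subset_closure_image hc ⟨h, hh, rfl⟩
  exact closure_mono himg this

omit [IsTopologicalGroup Ĝ] in
/-- A homomorphism to a discrete group whose kernel is open is continuous ([EtTh] p. 24: "the discreteness of
the topological group `Z`"). [cite: MochizukiEtTh2009, §1 p.12] -/
theorem continuous_of_isOpen_ker {M : Type*} [Group M] [TopologicalSpace M] [DiscreteTopology M]
    (f : G →* M) (hf : IsOpen (f.ker : Set G)) : Continuous f := by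
  refine continuous_of_continuousAt_one f ?_
  rw [ContinuousAt, map_one, Filter.tendsto_def]
  intro s hs
  have h1 : (1 : M) ∈ s := mem_of_mem_nhds hs
  refine Filter.mem_of_superset (hf.mem_nhds (one_mem f.ker)) fun x hx => ?_
  show f x ∈ s
  rwa [(hx : f x = 1)]

/-- **The profinite completion of `τ : G ↠ ℤ`.**  If `ι : G → Ĝ` is a profinite completion and `τ : G → ℤ`
has open kernel, there is a continuous homomorphism `Λ : Ĝ → Ẑ` with `Λ (ι g) = η(τ g)`: every finite level
`G → ℤ/H` extends uniquely to `Ĝ` and the extensions are compatible by density ([EtTh] p. 12: the profinite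
`Π_X` and the surjection `Π^tp_X ↠ Z`). [cite: MochizukiEtTh2009, §1 p.12] -/
theorem exists_hom_zHat (hι : IsProfiniteCompletion ι) (τ : G →* Multiplicative ℤ)
    (hτ : IsOpen (τ.ker : Set G)) :
    ∃ Λ : Ĝ →ₜ* completion (GrpCat.of (Multiplicative ℤ)),
      ∀ g : G, Λ (ι g) = etaFn (GrpCat.of (Multiplicative ℤ)) (τ g) := by
  classical
  haveI : T2Space Ĝ := hι.t2Space
  -- the finite levels, extended to `Ĝ`
  have hlev : ∀ H : FiniteIndexNormalSubgroup (Multiplicative ℤ),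
      ∃ F : Ĝ →* Multiplicative ℤ ⧸ H.toSubgroup,
        (∀ b, IsOpen (F ⁻¹' {b})) ∧ ∀ g, F (ι g) = QuotientGroup.mk (τ g) := by
    intro H
    haveI : DiscreteTopology (Multiplicative ℤ ⧸ H.toSubgroup) := QuotientGroup.discreteTopology (isOpen_discrete _)
    let f : G →* Multiplicative ℤ ⧸ H.toSubgroup := (QuotientGroup.mk' H.toSubgroup).comp τ
    have hfo : IsOpen (f.ker : Set G) := by
      refine Subgroup.isOpen_mono (fun x hx => ?_) hτ
      rw [MonoidHom.mem_ker] at hx ⊢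
      change QuotientGroup.mk (τ x) = (1 : Multiplicative ℤ ⧸ H.toSubgroup)
      rw [hx, QuotientGroup.mk_one]
    obtain ⟨F, hF⟩ := hι.exists_extend ⟨f, continuous_of_isOpen_ker f hfo⟩
    exact ⟨F.toMonoidHom, fun b => (isOpen_discrete {b}).preimage F.continuous, fun g => hF g⟩
  choose F hFo hFι using hlev
  -- continuity of the levels (for the discrete topology of the finite quotients)
  have hFc : ∀ H : FiniteIndexNormalSubgroup (Multiplicative ℤ), Continuous (F H) := fun H => by
    haveI : DiscreteTopology (Multiplicative ℤ ⧸ H.toSubgroup) := QuotientGroup.discreteTopology (isOpen_discrete _)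
    exact continuous_discrete_rng.2 (hFo H)
  -- compatibility of the levels, by density
  have hcompat : ∀ {H K : FiniteIndexNormalSubgroup (Multiplicative ℤ)} (hHK : H ≤ K) (x : Ĝ),
      QuotientGroup.map H.toSubgroup K.toSubgroup (MonoidHom.id _) hHK (F H x) = F K x := by
    intro H K hHK
    haveI : DiscreteTopology (Multiplicative ℤ ⧸ H.toSubgroup) := QuotientGroup.discreteTopology (isOpen_discrete _)
    haveI : DiscreteTopology (Multiplicative ℤ ⧸ K.toSubgroup) := QuotientGroup.discreteTopology (isOpen_discrete _)
    have heq := hι.denseRange.equalizer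
      (g := fun x => QuotientGroup.map H.toSubgroup K.toSubgroup (MonoidHom.id _) hHK (F H x))
      (h := fun x => F K x) (continuous_of_discreteTopology.comp (hFc H)) (hFc K)
      (funext fun g => by
        show QuotientGroup.map H.toSubgroup K.toSubgroup (MonoidHom.id _) hHK (F H (ι g)) = F K (ι g)
        rw [hFι H g, hFι K g, QuotientGroup.map_mk, MonoidHom.id_apply])
    exact fun x => congr_fun heq x
  -- the homomorphism to the limit
  let Λ₀ : Ĝ →* completion (GrpCat.of (Multiplicative ℤ)) :=
    { toFun := fun x => ⟨fun H => F H x, fun H K π => hcompat π.le x⟩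
      map_one' := Subtype.ext (funext fun H => map_one (F H))
      map_mul' := fun x y => Subtype.ext (funext fun H => map_mul (F H) x y) }
  have hΛc : Continuous Λ₀ := by
    refine continuous_induced_rng.2 (continuous_pi fun H => ?_)
    haveI : DiscreteTopology ((diagram (GrpCat.of (Multiplicative ℤ))).obj H) := ⟨rfl⟩
    exact continuous_discrete_rng.2 fun b => hFo H b
  exact ⟨⟨Λ₀, hΛc⟩, fun g => Subtype.ext (funext fun H => hFι H g)⟩

omit [IsTopologicalGroup G] in
/-- **The kernel of the completed surjection on a closure.**  With `Λ : Ĝ → Ẑ` the profinite completion of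
`τ : G → ℤ` (`Λ (ι g) = η(τ g)`) and `A ≤ G` a subgroup containing an element `σ` with `τ σ = 1`:
`Ker Λ ∩ (ι A)⁻ = (ι (A ∩ Ker τ))⁻` — for `A = Δ^tp_X` this is "`Δ^tp_X/Δ^tp_Y ≅ Z`" ([EtTh] p. 13) read in the
profinite completion.  Proof (`⊆`): for `d` in the left side and an open normal `V ⊴ Ĝ` of index `m`,
`ι σ^m ∈ V`; an `A`-approximant `ι a ∈ d·(V ∩ Ker Λ_m)` has `m ∣ τ a`, and `a·(σ^m)^{-τ a/m} ∈ A ∩ Ker τ` maps into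
`d·V`. [cite: MochizukiEtTh2009, §1 p.13] -/
theorem ker_inf_closure_map_eq (hι : IsProfiniteCompletion ι) {τ : G →* Multiplicative ℤ}
    {Λ : Ĝ →ₜ* completion (GrpCat.of (Multiplicative ℤ))}
    (hΛ : ∀ g : G, Λ (ι g) = etaFn (GrpCat.of (Multiplicative ℤ)) (τ g))
    (A : Subgroup G) (hA : ∃ σ ∈ A, τ σ = Multiplicative.ofAdd 1) :
    Λ.toMonoidHom.ker ⊓ (A.map ι.toMonoidHom).topologicalClosure =
      ((A ⊓ τ.ker).map ι.toMonoidHom).topologicalClosure := by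
  classical
  haveI : CompactSpace Ĝ := hι.compactSpace
  haveI : T2Space Ĝ := hι.t2Space
  haveI : TotallyDisconnectedSpace Ĝ := hι.totallyDisconnectedSpace
  refine le_antisymm ?_ ?_
  · rintro d ⟨hdker, hdA⟩
    have hΛd : Λ d = 1 := hdker
    change d ∈ closure (((A ⊓ τ.ker).map ι.toMonoidHom : Subgroup Ĝ) : Set Ĝ)
    rw [mem_closure_iff]
    intro U hU hdU
    -- an open normal subgroup `V` with `d·V ⊆ U`
    have hU₁ : IsOpen ((fun v : Ĝ => d * v) ⁻¹' U) := hU.preimage (by fun_prop)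
    obtain ⟨V, hV⟩ := ProfiniteGrp.exist_openNormalSubgroup_sub_open_nhds_of_one hU₁
      (show d * 1 ∈ U by rwa [mul_one])
    haveI : V.toSubgroup.Normal := V.isNormal'
    haveI : V.toSubgroup.FiniteIndex := Subgroup.finiteIndex_of_finite_quotient
    obtain ⟨σ, hσA, hσ⟩ := hA
    obtain ⟨m, hm⟩ : ∃ m : ℕ, V.toSubgroup.index = m := ⟨_, rfl⟩
    have hmpos : 0 < m := hm ▸ Nat.pos_of_ne_zero Subgroup.FiniteIndex.index_ne_zero
    have hσV : (ι σ) ^ m ∈ V.toSubgroup := hm ▸ V.toSubgroup.pow_index_mem (ι σ)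
    let H₀ : FiniteIndexNormalSubgroup (Multiplicative ℤ) := ZHatLevel.kerLevel ⟨m, hmpos⟩
    -- the `H₀`-component of `Λ`
    let π₀ : Ĝ → Multiplicative ℤ ⧸ H₀.toSubgroup := fun x => (Λ x).val H₀
    have hπ₀o : IsOpen (π₀ ⁻¹' {1}) := by
      haveI : DiscreteTopology ((diagram (GrpCat.of (Multiplicative ℤ))).obj H₀) := ⟨rfl⟩
      have hc : Continuous π₀ :=
        (Literature.AnabelianGeometry.AbsoluteAnabelian.ZHatCompletion.continuous_val H₀).comp Λ.continuous
      exact (isOpen_discrete _).preimage hc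
    have hπ₀mul : ∀ x y, π₀ (x * y) = π₀ x * π₀ y := fun x y => by
      show (Λ (x * y)).val H₀ = (Λ x).val H₀ * (Λ y).val H₀; rw [map_mul]; rfl
    have hπ₀d : π₀ d = 1 := by show (Λ d).val H₀ = 1; rw [hΛd]; rfl
    have hπ₀ι : ∀ g : G, π₀ (ι g) = QuotientGroup.mk (τ g) := fun g => by
      show (Λ (ι g)).val H₀ = _; rw [hΛ g]; rfl
    -- the open neighbourhood `d·(V ∩ Ker π₀)` of `d` meets `ι A`
    have hO : IsOpen ((fun x : Ĝ => d⁻¹ * x) ⁻¹' ((V : Set Ĝ) ∩ π₀ ⁻¹' {1})) :=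
      (V.isOpen.inter hπ₀o).preimage (by fun_prop)
    have hdO : d ∈ (fun x : Ĝ => d⁻¹ * x) ⁻¹' ((V : Set Ĝ) ∩ π₀ ⁻¹' {1}) := by
      refine ⟨?_, ?_⟩
      · show d⁻¹ * d ∈ (V : Set Ĝ); rw [inv_mul_cancel]; exact one_mem V
      · show π₀ (d⁻¹ * d) = 1; rw [inv_mul_cancel]; show (Λ 1).val H₀ = 1; rw [map_one]; rfl
    have hdA' : d ∈ closure ((A.map ι.toMonoidHom : Subgroup Ĝ) : Set Ĝ) := hdA
    obtain ⟨_, ⟨hxV, hxπ⟩, ⟨a, haA, rfl⟩⟩ := mem_closure_iff.1 hdA' _ hO hdO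
    have hxV' : d⁻¹ * ι a ∈ V.toSubgroup := hxV
    have hxπ' : π₀ (d⁻¹ * ι a) = 1 := hxπ
    -- hence `m ∣ τ a`
    have hτa : (QuotientGroup.mk (τ a) : Multiplicative ℤ ⧸ H₀.toSubgroup) = 1 := by
      rw [← hπ₀ι a]
      have : π₀ (ι a) = π₀ d * π₀ (d⁻¹ * ι a) := by rw [← hπ₀mul, mul_inv_cancel_left]
      rw [this, hπ₀d, one_mul, hxπ']
    rw [QuotientGroup.eq_one_iff] at hτa
    obtain ⟨k, hk⟩ : ((m : ℕ) : ℤ) ∣ Multiplicative.toAdd (τ a) :=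
      (ZHatLevel.mem_kerLevel_iff ⟨m, hmpos⟩ (τ a)).1 hτa
    -- the correcting element `w = (σ^m)^k ∈ A ∩ ι⁻¹ V` with `τ w = τ a`
    have hwA : (σ ^ m) ^ k ∈ A := A.zpow_mem (A.pow_mem hσA m) k
    have hwV : ι ((σ ^ m) ^ k) ∈ V.toSubgroup := by
      rw [map_zpow, map_pow]; exact V.toSubgroup.zpow_mem hσV k
    have hτw : τ ((σ ^ m) ^ k) = τ a := by
      apply Multiplicative.toAdd.injective
      rw [hk, map_zpow, map_pow, hσ, toAdd_zpow, toAdd_pow, toAdd_ofAdd, smul_eq_mul, nsmul_eq_mul,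
        mul_one, mul_comm]
    -- `y := a·w⁻¹ ∈ A ∩ Ker τ` with `ι y ∈ d·V ⊆ U`
    refine ⟨ι (a * ((σ ^ m) ^ k)⁻¹), ?_, ⟨a * ((σ ^ m) ^ k)⁻¹, ⟨A.mul_mem haA (A.inv_mem hwA), ?_⟩, rfl⟩⟩
    · have hmem : d⁻¹ * ι (a * ((σ ^ m) ^ k)⁻¹) ∈ (V : Set Ĝ) := by
        rw [map_mul, map_inv, ← mul_assoc]
        exact V.toSubgroup.mul_mem hxV' (V.toSubgroup.inv_mem hwV)
      simpa only [Set.mem_preimage, mul_inv_cancel_left] using hV hmem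
    · show τ (a * ((σ ^ m) ^ k)⁻¹) = 1
      rw [map_mul, map_inv, hτw, mul_inv_cancel]
  · refine le_inf ?_ (Subgroup.topologicalClosure_mono (Subgroup.map_mono inf_le_left))
    refine Subgroup.topologicalClosure_minimal _ ?_ ?_
    · rintro _ ⟨g, hg, rfl⟩
      have hg' : τ g = 1 := (inf_le_right : A ⊓ τ.ker ≤ τ.ker) hg
      rw [MonoidHom.mem_ker]
      show Λ (ι g) = 1
      rw [hΛ g, hg']; rfl
    · have : ((Λ.toMonoidHom.ker : Subgroup Ĝ) : Set Ĝ) = Λ ⁻¹' {1} := by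
        ext x; simp [MonoidHom.mem_ker]
      rw [this]
      exact isClosed_singleton.preimage Λ.continuous

omit [IsTopologicalGroup G] in
/-- **Surjectivity on a closure.**  With `Λ` the profinite completion of `τ` and `A ≤ G` a subgroup on which `τ`
is surjective, `Λ((ι A)⁻) = Ẑ`: the image is compact, hence closed, and contains the dense `η(ℤ)` ([EtTh] p. 13
"`Δ^tp_X/Δ^tp_Y ≅ Z`", completed). [cite: MochizukiEtTh2009, §1 p.13] -/
theorem surjOn_closure_map (hι : IsProfiniteCompletion ι) {τ : G →* Multiplicative ℤ}
    {Λ : Ĝ →ₜ* completion (GrpCat.of (Multiplicative ℤ))}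
    (hΛ : ∀ g : G, Λ (ι g) = etaFn (GrpCat.of (Multiplicative ℤ)) (τ g))
    (A : Subgroup G) (hA : ∀ k : Multiplicative ℤ, ∃ a ∈ A, τ a = k) :
    Set.SurjOn Λ ((A.map ι.toMonoidHom).topologicalClosure : Set Ĝ) Set.univ := by
  haveI : CompactSpace Ĝ := hι.compactSpace
  intro z _
  have hC : IsClosed (((A.map ι.toMonoidHom).topologicalClosure : Subgroup Ĝ) : Set Ĝ) :=
    Subgroup.isClosed_topologicalClosure _
  have himg : IsClosed (Λ '' (((A.map ι.toMonoidHom).topologicalClosure : Subgroup Ĝ) : Set Ĝ)) :=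
    (hC.isCompact.image Λ.continuous).isClosed
  have hsub : Set.range (etaFn (GrpCat.of (Multiplicative ℤ))) ⊆
      Λ '' (((A.map ι.toMonoidHom).topologicalClosure : Subgroup Ĝ) : Set Ĝ) := by
    rintro _ ⟨k, rfl⟩
    obtain ⟨a, haA, hτa⟩ := hA k
    exact ⟨ι a, Subgroup.le_topologicalClosure _ ⟨a, haA, rfl⟩, by rw [hΛ a, hτa]⟩
  have h := himg.closure_subset_iff.2 hsub
  rw [(denseRange (GrpCat.of (Multiplicative ℤ))).closure_range] at h
  exact h (Set.mem_univ z)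

omit [IsTopologicalGroup G] in
/-- A continuous surjective homomorphism from a compact group onto a Hausdorff group induces a TOPOLOGICAL
isomorphism from the quotient by its kernel (continuous bijection compact → Hausdorff); bookkeeping for the
quotients `Π_X/(ι Π^tp_Y)⁻`, `Δ_X/(ι Δ^tp_Y)⁻` below. [cite: MochizukiEtTh2009, §1 p.12] -/
theorem nonempty_quotient_continuousMulEquiv_of_surjective {Γ M : Type*} [Group Γ] [TopologicalSpace Γ]
    [IsTopologicalGroup Γ] [CompactSpace Γ] [Group M] [TopologicalSpace M] [T2Space M]
    (f : Γ →* M) (hf : Continuous f) (hs : Function.Surjective f) (K : Subgroup Γ) [K.Normal]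
    (hK : f.ker = K) : Nonempty (Γ ⧸ K ≃ₜ* M) := by
  let e : Γ ⧸ K ≃* M :=
    (QuotientGroup.quotientMulEquivOfEq hK).symm.trans (QuotientGroup.quotientKerEquivOfSurjective f hs)
  have hemk : ∀ x : Γ, e (QuotientGroup.mk x) = f x := fun x => rfl
  have he : Continuous e := by
    rw [(QuotientGroup.isQuotientMap_mk _).continuous_iff]
    have : (e ∘ QuotientGroup.mk) = f := funext hemk
    rw [this]; exact hf
  haveI : CompactSpace (Γ ⧸ K) := Quotient.compactSpace
  let h := Continuous.homeoOfEquivCompactToT2 (f := e.toEquiv) he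
  exact ⟨{ e with continuous_toFun := he, continuous_invFun := h.continuous_invFun }⟩

end ClosureKerZHat

/-! ## The [EtTh] §1 setting: `Π_X/(ι Π^tp_Y)⁻ ≅ Ẑ` and `Δ_X/(ι Δ^tp_Y)⁻ ≅ Ẑ` -/

namespace ThetaSetting

variable {p : ℕ} [Fact p.Prime] (D : ThetaSetting p)

/-- `(ι Π^tp_Y)⁻ ⊴ Π_X`: the closure in the profinite completion `Π_X` of the image of `Π^tp_Y = Ker(Π^tp_X ↠ Z)`
is normal ([EtTh] p. 12: `Y → X` Galois with group `Z`). [cite: MochizukiEtTh2009, §1 p.12] -/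
theorem closureGtpY_normal : ((D.GtpY.map D.toHat.toMonoidHom).topologicalClosure).Normal := by
  haveI : D.GtpY.Normal := by unfold GtpY; infer_instance
  exact ClosureKerZHat.normal_topologicalClosure_map D.isProfiniteCompletion_toHat.denseRange D.GtpY

/-- `(ι Δ^tp_Y)⁻ ⊴ Π_X`: the closure in `Π_X` of the image of `Δ^tp_Y = Π^tp_Y ∩ Δ^tp_X` is normal ([EtTh] p. 12).
[cite: MochizukiEtTh2009, §1 p.12] -/
theorem closureDtpY_normal : ((D.DtpY.map D.toHat.toMonoidHom).topologicalClosure).Normal := by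
  haveI : D.GtpY.Normal := by unfold GtpY; infer_instance
  haveI : D.DtpY.Normal := by unfold DtpY TemperedCurve.DeltaTemp; infer_instance
  exact ClosureKerZHat.normal_topologicalClosure_map D.isProfiniteCompletion_toHat.denseRange D.DtpY

/-- `(ι Δ^tp_Y)⁻ ≤ Δ_X = (ι Δ^tp_X)⁻` ([EtTh] p. 12). [cite: MochizukiEtTh2009, §1 p.12] -/
theorem closureDtpY_le_deltaHat : (D.DtpY.map D.toHat.toMonoidHom).topologicalClosure ≤ D.DeltaHat :=
  Subgroup.topologicalClosure_mono (Subgroup.map_mono (inf_le_right : D.DtpY ≤ D.DeltaTemp))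

/-- **The profinite completion `Λ : Π_X ↠ Ẑ` of `Π^tp_X ↠ Z`** ([EtTh] p. 12 "a natural surjection `Π^tp_X ↠ Z`",
p. 13 "`Δ^tp_X/Δ^tp_Y ≅ Z`"), for EVERY theta setting (no origin guard): a continuous surjective homomorphism
`Λ : Π_X → Ẑ` with `Λ (ι x) = η(toZ x)` on `Π^tp_X`, `Ker Λ = (ι Π^tp_Y)⁻`, `Λ(Δ_X) = Ẑ` and
`Ker Λ ∩ Δ_X = (ι Δ^tp_Y)⁻`. [cite: MochizukiEtTh2009, §1 p.12] -/
theorem exists_piHat_hom_zHat :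
    ∃ Λ : D.PiHat →ₜ* ZHat,
      (∀ x : D.PiTemp, Λ (D.toHat x) = ZHatLevel.eta (Multiplicative.toAdd (D.toZ x))) ∧
      Function.Surjective Λ ∧
      Λ.toMonoidHom.ker = (D.GtpY.map D.toHat.toMonoidHom).topologicalClosure ∧
      Set.SurjOn Λ (D.DeltaHat : Set D.PiHat) Set.univ ∧
      Λ.toMonoidHom.ker ⊓ D.DeltaHat = (D.DtpY.map D.toHat.toMonoidHom).topologicalClosure := by
  have hι := D.isProfiniteCompletion_toHat
  obtain ⟨Λ, hΛ⟩ := ClosureKerZHat.exists_hom_zHat hι D.toZ D.isOpen_ker_toZ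
  have hAΔ : ∃ σ ∈ D.DeltaTemp, D.toZ σ = Multiplicative.ofAdd 1 := by
    obtain ⟨⟨σ, hσ⟩, h⟩ := D.toZ_delta_surjective (Multiplicative.ofAdd 1)
    exact ⟨σ, hσ, h⟩
  have hAΔ' : ∀ k : Multiplicative ℤ, ∃ a ∈ D.DeltaTemp, D.toZ a = k := fun k => by
    obtain ⟨⟨a, ha⟩, h⟩ := D.toZ_delta_surjective k
    exact ⟨a, ha, h⟩
  have hAtop : ∃ σ ∈ (⊤ : Subgroup D.PiTemp), D.toZ σ = Multiplicative.ofAdd 1 := by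
    obtain ⟨σ, -, h⟩ := hAΔ
    exact ⟨σ, Subgroup.mem_top σ, h⟩
  -- `Π`-level kernel
  have hkerTop := ClosureKerZHat.ker_inf_closure_map_eq hι hΛ ⊤ hAtop
  have htop : ((⊤ : Subgroup D.PiTemp).map D.toHat.toMonoidHom).topologicalClosure = ⊤ := by
    rw [eq_top_iff]
    intro x _
    change x ∈ closure ((((⊤ : Subgroup D.PiTemp).map D.toHat.toMonoidHom) : Subgroup D.PiHat) : Set D.PiHat)
    rw [Subgroup.coe_map, Subgroup.coe_top, Set.image_univ]
    exact hι.denseRange x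
  rw [htop, inf_top_eq, top_inf_eq] at hkerTop
  -- `Δ`-level kernel and surjectivity
  have hkerΔ := ClosureKerZHat.ker_inf_closure_map_eq hι hΛ D.DeltaTemp hAΔ
  have hsurjΔ := ClosureKerZHat.surjOn_closure_map hι hΛ D.DeltaTemp hAΔ'
  have hDtpY : D.DeltaTemp ⊓ D.toZ.ker = D.DtpY := by
    unfold DtpY GtpY; exact inf_comm _ _
  rw [hDtpY] at hkerΔ
  refine ⟨Λ, fun x => hΛ x, fun z => ?_, hkerTop, hsurjΔ, hkerΔ⟩
  obtain ⟨d, -, hd⟩ := hsurjΔ (Set.mem_univ z)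
  exact ⟨d, hd⟩

/-- **`Π_X/(ι Π^tp_Y)⁻ ≅ Ẑ` as TOPOLOGICAL groups** ([EtTh] p. 12: `Y → X` is Galois with group `Z ≅ ℤ`;
profinite form: quotient topology on `Π_X`, a continuous bijection onto the Hausdorff `Ẑ`).  The normality
instance of the closure is `closureGtpY_normal`. [cite: MochizukiEtTh2009, §1 p.12] -/
theorem nonempty_piHat_quotient_continuousMulEquiv_zHat
    [((D.GtpY.map D.toHat.toMonoidHom).topologicalClosure).Normal] :
    Nonempty (D.PiHat ⧸ (D.GtpY.map D.toHat.toMonoidHom).topologicalClosure ≃ₜ* ZHat) := by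
  obtain ⟨Λ, -, hsurj, hker, -, -⟩ := D.exists_piHat_hom_zHat
  haveI : CompactSpace D.PiHat := D.isProfiniteCompletion_toHat.compactSpace
  exact ClosureKerZHat.nonempty_quotient_continuousMulEquiv_of_surjective Λ.toMonoidHom Λ.continuous hsurj
    _ hker

/-- **`Π_X/(ι Π^tp_Y)⁻ ≅ Ẑ`** as abstract groups ([EtTh] p. 12). [cite: MochizukiEtTh2009, §1 p.12] -/
theorem nonempty_piHat_quotient_mulEquiv_zHat [((D.GtpY.map D.toHat.toMonoidHom).topologicalClosure).Normal] :
    Nonempty (D.PiHat ⧸ (D.GtpY.map D.toHat.toMonoidHom).topologicalClosure ≃* ZHat) := by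
  obtain ⟨e⟩ := D.nonempty_piHat_quotient_continuousMulEquiv_zHat
  exact ⟨e.toMulEquiv⟩

/-- **`Δ_X/(ι Δ^tp_Y)⁻ ≅ Ẑ` as TOPOLOGICAL groups** ([EtTh] p. 13 "`Δ^tp_X/Δ^tp_Y ≅ Z`"; profinite form: quotient
topology on the compact `Δ_X`, a continuous bijection onto the Hausdorff `Ẑ`) — the X-level complement of
abc-iut-w5-d006's `(ι Δ^tp_Y)⁻/((ι Δ^tp_Y)⁻ ∩ [Δ_X,Δ_X]⁻) ≅ Ẑ`.  The normality instance is
`(closureDtpY_normal D).subgroupOf D.DeltaHat`. [cite: MochizukiEtTh2009, §1 p.13] -/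
theorem nonempty_deltaHat_quotient_continuousMulEquiv_zHat
    [(((D.DtpY.map D.toHat.toMonoidHom).topologicalClosure).subgroupOf D.DeltaHat).Normal] :
    Nonempty (↥D.DeltaHat ⧸ ((D.DtpY.map D.toHat.toMonoidHom).topologicalClosure).subgroupOf D.DeltaHat ≃ₜ*
      ZHat) := by
  obtain ⟨Λ, -, -, -, hsurjΔ, hkerΔ⟩ := D.exists_piHat_hom_zHat
  haveI : CompactSpace D.PiHat := D.isProfiniteCompletion_toHat.compactSpace
  haveI : CompactSpace ↥D.DeltaHat :=
    isCompact_iff_compactSpace.1 (Subgroup.isClosed_topologicalClosure _).isCompact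
  let ΛΔ : ↥D.DeltaHat →* ZHat := Λ.toMonoidHom.comp D.DeltaHat.subtype
  have hsurj : Function.Surjective ΛΔ := fun z => by
    obtain ⟨d, hd, h⟩ := hsurjΔ (Set.mem_univ z)
    exact ⟨⟨d, hd⟩, h⟩
  have hker : ΛΔ.ker = ((D.DtpY.map D.toHat.toMonoidHom).topologicalClosure).subgroupOf D.DeltaHat := by
    ext ⟨d, hd⟩
    rw [MonoidHom.mem_ker, Subgroup.mem_subgroupOf, ← hkerΔ, Subgroup.mem_inf, MonoidHom.mem_ker]
    exact ⟨fun h => ⟨h, hd⟩, fun h => h.1⟩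
  exact ClosureKerZHat.nonempty_quotient_continuousMulEquiv_of_surjective ΛΔ
    (Λ.continuous.comp continuous_subtype_val) hsurj _ hker

/-- **`Δ_X/(ι Δ^tp_Y)⁻ ≅ Ẑ`** as abstract groups ([EtTh] p. 13 "`Δ^tp_X/Δ^tp_Y ≅ Z`"; profinite form).
[cite: MochizukiEtTh2009, §1 p.13] -/
theorem nonempty_deltaHat_quotient_mulEquiv_zHat
    [(((D.DtpY.map D.toHat.toMonoidHom).topologicalClosure).subgroupOf D.DeltaHat).Normal] :
    Nonempty (↥D.DeltaHat ⧸ ((D.DtpY.map D.toHat.toMonoidHom).topologicalClosure).subgroupOf D.DeltaHat ≃*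
      ZHat) := by
  obtain ⟨e⟩ := D.nonempty_deltaHat_quotient_continuousMulEquiv_zHat
  exact ⟨e.toMulEquiv⟩

end ThetaSetting

end Literature.AnabelianGeometry.EtaleTheta

end
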